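import Summits.CriticalPhenomena.PercolationContinuityZ3.Theorems.PercNearOneGluingNoHeavyLowerTailSahiC3CubeCertCheck
import Literature.Probability.LatticeModels.SahiThirdOrderCorrelation
import Literature.Probability.Percolation.ProdBernoulliRusso

/-!
# `NoHeavyLowerTail` (crux stmt-CriticalPhenomena-4575), Sahi programme P1: from the cube certificate to Sahi's inequality
# `E₃ ≥ 0` for increasing events of `Set (Fin m)` under `prodBernoulli` — the bridge

Support file (Sahi cell, seat `prim-sahi-p1`; `--supports stmt-CriticalPhenomena-4575`).  Continues `…SahiC3CubeCertCheck`
(bitmask tables, three-copy digit test `checkTriple`, cube check `checkCube`).  Here: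

* `pt`, `ofBits`, `encA`, `testBit_encA` — every event `A ⊆ Set (Fin m)` has a bitmask `encA m A < 2^(2^m)` (bit `x` set iff
  the point with coordinate set = binary expansion of `x` lies in `A`); `testBit_enc2`, `pt_enc2`, `tabZ_encA` identify its
  corner table with the indicator of `A`;
* `real_eq_ML_cube` — `(prodBernoulli p).real A = ML (table of encA m A) p` (Russo's cylinder formula
  `RussoPath.prodBernoulli_real_eq_sum_powerset` on the finite index set); `tabR_encA_inter` (intersections = products);
* `isUpN_encA`, `encA_mem_upsN` — increasing events have increasing bitmasks, hence are covered by `checkCube`;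
* `sahiE3_nonneg_of_checkTriple`, `forall_of_sorted` (symmetry of `E₃`), and the main
  **`sahiE3_nonneg_of_checkCube`**: if `checkCube m σ = true` then `0 ≤ sahiE3 (prodBernoulli p) A B C` for every
  `p : Fin m → [0,1]` and all increasing `A B C : Set (Set (Fin m))` (Sahi 2008 Conj. 5 / Kahn 2022 Conj. 5 on `{0,1}^m`).

Evaluations: `…SahiC3CubeLeThree` (`m ≤ 3`, kernel `decide`), `…SahiC3CubeFour` (`m = 4`, `native_decide`).  Nothing is asserted
about the crux.
-/

namespace Summit.CriticalPhenomena.PercolationContinuityZ3.Theorems.SahiC3Cube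

open Finset MeasureTheory OneCutCert CovTransferCert
open scoped BigOperators
open Literature.Probability.Percolation Literature.Probability.LatticeModels

/-! ## Events of the cube `Set (Fin m)`: bitmasks, tables, probabilities -/

/-- The point of the cube encoded by `x`: coordinate `i` is present iff bit `i` of `x` is set. [this work] -/
def pt (m x : ℕ) : Set (Fin m) := {i | x.testBit i = true}

/-- The number with the given bits below `k`. [this work] -/
def ofBits (f : ℕ → Bool) : ℕ → ℕ
  | 0 => 0
  | k + 1 => ofBits f k + 2 ^ k * (f k).toNat

/-- `ofBits f k < 2^k`. [this work] -/
theorem ofBits_lt (f : ℕ → Bool) : ∀ k, ofBits f k < 2 ^ k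
  | 0 => by simp [ofBits]
  | k + 1 => by
    have ih := ofBits_lt f k
    have hb : (f k).toNat ≤ 1 := by cases f k <;> simp
    unfold ofBits
    calc ofBits f k + 2 ^ k * (f k).toNat < 2 ^ k + 2 ^ k * 1 := by
          have := Nat.mul_le_mul_left (2 ^ k) hb; omega
      _ = 2 ^ (k + 1) := by rw [pow_succ]; ring

/-- The bits of `ofBits`. [this work] -/
theorem testBit_ofBits (f : ℕ → Bool) : ∀ k i, (ofBits f k).testBit i = (decide (i < k) && f i)
  | 0, i => by simp [ofBits]
  | k + 1, i => by
    unfold ofBits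
    rw [add_comm, Nat.testBit_two_pow_mul_add _ (ofBits_lt f k), testBit_ofBits f k]
    split_ifs with hi
    · simp [hi, Nat.lt_succ_of_lt hi]
    · rw [Nat.testBit_bool_toNat]
      rcases Nat.eq_or_lt_of_le (not_lt.1 hi) with h | h
      · subst h; simp
      · have h1 : ¬ (i - k = 0) := by omega
        have h2 : ¬ (i < k + 1) := by omega
        simp [h1, h2]

open Classical in
/-- The bitmask of an event `A ⊆ Set (Fin m)`: bit `x < 2^m` is set iff `pt m x ∈ A`. [this work] -/
noncomputable def encA (m : ℕ) (A : Set (Set (Fin m))) : ℕ := ofBits (fun x => decide (pt m x ∈ A)) (2 ^ m)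

/-- `encA m A < 2^(2^m)`. [this work] -/
theorem encA_lt (m : ℕ) (A : Set (Set (Fin m))) : encA m A < 2 ^ (2 ^ m) := ofBits_lt _ _

open Classical in
/-- The bits of `encA`. [this work] -/
theorem testBit_encA (m : ℕ) (A : Set (Set (Fin m))) (x : ℕ) :
    (encA m A).testBit x = (decide (x < 2 ^ m) && decide (pt m x ∈ A)) := by
  unfold encA; rw [testBit_ofBits]

/-- The bits of the corner position `enc2 g` are the coordinates of `g`. [this work] -/
theorem testBit_enc2 : ∀ {m : ℕ} (g : Fin m → Bool) (i : ℕ),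
    (enc2 g).testBit i = if h : i < m then g ⟨i, h⟩ else false
  | 0, g, i => by simp [enc2]
  | m + 1, g, i => by
    unfold enc2
    rw [mul_comm, add_comm, Nat.testBit_two_pow_mul_add _ (enc2_lt _), testBit_enc2]
    split_ifs with h1 h2 h2 <;> try rfl
    · omega
    · rw [Nat.testBit_bool_toNat]
      have him : i = m := by omega
      subst him
      simp only [Nat.sub_self, decide_true, Bool.true_and]
      rfl
    · rw [Nat.testBit_bool_toNat]
      have h3 : ¬ (i - m = 0) := by omega
      simp [h3]

/-- The point at the corner position of `g` is the coordinate set of `g`. [this work] -/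
theorem pt_enc2 {m : ℕ} (g : Fin m → Bool) : pt m (enc2 g) = {i | g i = true} := by
  ext i
  simp only [pt, Set.mem_setOf_eq, testBit_enc2, dif_pos i.2]

open Classical in
/-- The table of `encA m A` is the indicator of `A` on corners. [this work] -/
theorem tabZ_encA {m : ℕ} (A : Set (Set (Fin m))) (g : Fin m → Bool) :
    tabZ m (encA m A) g = if {i | g i = true} ∈ A then 1 else 0 := by
  rw [tabZ_apply, testBit_encA, ← pt_enc2]
  simp only [enc2_lt g, decide_true, Bool.true_and, decide_eq_true_eq]

/-- Every event of `Set (Fin m)` is determined by all coordinates. [folklore] -/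
theorem determinedBy_univ_coords {m : ℕ} (A : Set (Set (Fin m))) :
    DeterminedBy A (↑(Finset.univ : Finset (Fin m)) : Set (Fin m)) := by
  rw [Finset.coe_univ, determinedBy_iff]
  intro ω ω' h
  rw [Set.inter_univ, Set.inter_univ] at h
  rw [h]

open Classical in
/-- **Probabilities of cube events as multilinear polynomials of their bitmask tables**:
`(prodBernoulli p).real A = ML (tabR m (encA m A)) p`. [this work] -/
theorem real_eq_ML_cube {m : ℕ} (p : Fin m → unitInterval) (A : Set (Set (Fin m))) :
    (prodBernoulli p).real A = ML (tabR m (encA m A)) (fun i => (p i : ℝ)) := by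
  rw [RussoPath.prodBernoulli_real_eq_sum_powerset (determinedBy_univ_coords A) p]
  unfold ML
  symm
  refine Finset.sum_nbij' (fun g => Finset.univ.filter fun i => g i = true) (fun S i => decide (i ∈ S)) ?_ ?_ ?_ ?_ ?_
  · intro g _; simp
  · intro S _; exact Finset.mem_univ _
  · intro g _
    funext i
    by_cases h : g i = true
    · simp [h]
    · rw [Bool.not_eq_true] at h
      simp [h]
  · intro S _
    ext i
    simp
  · intro g _
    unfold tabR mono
    rw [tabZ_encA]
    have hS : (↑(Finset.univ.filter fun i => g i = true) : Set (Fin m)) = {i | g i = true} := by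
      ext i; simp
    rw [hS]
    split_ifs with hmem
    · push_cast
      rw [one_mul]
      refine Finset.prod_congr rfl fun i _ => ?_
      by_cases h : g i = true
      · simp [h]
      · rw [Bool.not_eq_true] at h
        simp [h]
    · push_cast
      rw [zero_mul]

open Classical in
/-- Intersections: `encA` of `A ∩ B` has the product table. [this work] -/
theorem tabR_encA_inter {m : ℕ} (A B : Set (Set (Fin m))) :
    tabR m (encA m (A ∩ B)) = tabR m (encA m A &&& encA m B) := by
  rw [tabR_land]
  funext g
  simp only [tabR, tabZ_encA, Set.mem_inter_iff]
  by_cases hA : {i | g i = true} ∈ A <;> by_cases hB : {i | g i = true} ∈ B <;> simp [hA, hB]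

/-- An increasing event has an increasing bitmask. [this work] -/
theorem isUpN_encA {m : ℕ} {A : Set (Set (Fin m))} (hA : IsUpperSet A) : isUpN m (encA m A) = true := by
  classical
  unfold isUpN
  simp only [List.all_eq_true, List.mem_range, Bool.or_eq_true, Bool.not_eq_true']
  intro x hx i hi
  by_cases hxA : (encA m A).testBit x = true
  · right
    rw [testBit_encA] at hxA ⊢
    simp only [Bool.and_eq_true, decide_eq_true_eq] at hxA ⊢
    refine ⟨Nat.or_lt_two_pow hxA.1 (Nat.pow_lt_pow_right (by norm_num) hi), ?_⟩
    refine hA ?_ hxA.2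
    intro j hj
    simp only [pt, Set.mem_setOf_eq, Nat.testBit_or] at hj ⊢
    rw [hj, Bool.true_or]
  · left
    rw [Bool.not_eq_true] at hxA
    exact hxA

/-- An increasing event's bitmask is listed in `upsN`. [this work] -/
theorem encA_mem_upsN {m : ℕ} {A : Set (Set (Fin m))} (hA : IsUpperSet A) : encA m A ∈ upsN m := by
  unfold upsN
  rw [List.mem_filter, List.mem_range]
  exact ⟨encA_lt m A, isUpN_encA hA⟩

/-! ## From the check to Sahi's inequality -/

/-- `E₃ ≥ 0` for three events whose bitmasks pass `checkTriple`, under every product measure. [this work] -/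
theorem sahiE3_nonneg_of_checkTriple {m σ : ℕ} (p : Fin m → unitInterval) {A B C : Set (Set (Fin m))}
    (h : checkTriple σ m (encA m A) (encA m B) (encA m C) = true) : 0 ≤ sahiE3 (prodBernoulli p) A B C := by
  classical
  have hx : InCube (fun i => (p i : ℝ)) := fun i => ⟨(p i).2.1, (p i).2.2⟩
  have key := checkTriple_sound h hx
  have e : ∀ X : Set (Set (Fin m)), (prodBernoulli p).real X = ML (tabR m (encA m X)) (fun i => (p i : ℝ)) :=
    real_eq_ML_cube p
  rw [sahiE3_def, e, e, e, e, e, e, e]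
  simp only [tabR_encA_inter, tabR_land] at key ⊢
  exact key

/-- A symmetric ternary predicate holds everywhere once it holds on triples sorted by a key. [folklore] -/
theorem forall_of_sorted {α : Type*} (P : α → α → α → Prop) (f : α → ℕ)
    (h12 : ∀ a b c, P a b c → P b a c) (h23 : ∀ a b c, P a b c → P a c b)
    (h : ∀ a b c, f a ≤ f b → f b ≤ f c → P a b c) (a b c : α) : P a b c := by
  have h13 : ∀ a b c, P a b c → P c b a := fun a b c habc => h12 _ _ _ (h23 _ _ _ (h12 _ _ _ habc))
  rcases le_total (f a) (f b) with hab | hba <;> rcases le_total (f b) (f c) with hbc | hcb <;>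
    rcases le_total (f a) (f c) with hac | hca
  · exact h a b c hab hbc
  · exact h a b c hab hbc
  · exact h23 _ _ _ (h a c b hac hcb)
  · exact h23 _ _ _ (h12 _ _ _ (h c a b hca hab))
  · exact h12 _ _ _ (h b a c hba hac)
  · exact h12 _ _ _ (h23 _ _ _ (h b c a hbc hca))
  · exact h13 _ _ _ (h c b a hcb hba)
  · exact h13 _ _ _ (h c b a hcb hba)

/-- **Sahi's `C₃` on the `m`-cube from the cube check.**  If `checkCube m σ = true` then for every product measure
`prodBernoulli p`, `p : Fin m → [0,1]`, and all increasing events `A, B, C ⊆ Set (Fin m)`: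
`0 ≤ E₃(A,B,C) = 2μ(A∩B∩C) + μ(A)μ(B)μ(C) − μ(A)μ(B∩C) − μ(B)μ(A∩C) − μ(C)μ(A∩B)`. [this work] -/
theorem sahiE3_nonneg_of_checkCube {m σ : ℕ} (h : checkCube m σ = true) (p : Fin m → unitInterval)
    {A B C : Set (Set (Fin m))} (hA : IsUpperSet A) (hB : IsUpperSet B) (hC : IsUpperSet C) :
    0 ≤ sahiE3 (prodBernoulli p) A B C := by
  let P : {X : Set (Set (Fin m)) // IsUpperSet X} → {X : Set (Set (Fin m)) // IsUpperSet X} →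
      {X : Set (Set (Fin m)) // IsUpperSet X} → Prop := fun a b c => 0 ≤ sahiE3 (prodBernoulli p) a.1 b.1 c.1
  have key : P ⟨A, hA⟩ ⟨B, hB⟩ ⟨C, hC⟩ := by
    refine forall_of_sorted P (fun a => encA m a.1) ?_ ?_ ?_ ⟨A, hA⟩ ⟨B, hB⟩ ⟨C, hC⟩
    · intro a b c habc; simp only [P] at habc ⊢; rwa [sahiE3_comm₁₂]
    · intro a b c habc; simp only [P] at habc ⊢; rwa [sahiE3_comm₂₃]
    · intro a b c hab hbc
      exact sahiE3_nonneg_of_checkTriple p (checkTriple_of_checkCube h (encA_mem_upsN a.2) (encA_mem_upsN b.2)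
        (encA_mem_upsN c.2) hab hbc)
  exact key

end Summit.CriticalPhenomena.PercolationContinuityZ3.Theorems.SahiC3Cube
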